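import Literature.NumberTheory.GaloisRepresentations.ContinuousCohomologyFiniteTwoDevissage
import Literature.NumberTheory.GaloisCohomology.RestrictedRamificationCdTwoOfH3Mu
import Literature.NumberTheory.GaloisRepresentations.ContinuousH1FiniteOfBoundedIndex
import HarnessLib

/-!
# `H²(G_S, M)` is finite for finite `p`-primary `M` and finite `S ⊇ S_p` FROM ONE arithmetic
# statement: `H²(U, μ_p)` finite for the open `U ≤ G_{K,S}` fixing `μ_p` (NSW (8.3.20), proof)

Topic `NumberTheory/GaloisCohomology`; namespace `Literature.NumberTheory.GaloisCohomology`.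
THEOREMS ONLY (no definition, no named fact, no `sorry`, no instance).

Neukirch–Schmidt–Wingberg (8.3.20): "Let `S` be a finite set of primes … Then the groups
`Hⁿ(G_S, A)` are finite for every finite `G_S`-module `A` with `#A ∈ ℕ(S)`" (= Harari Cor. 17.17,
Milne ADT I Cor. 4.15 — the tree's NAMED FACT `finite_restrictedCohomology K`).  The printed proof
reduces, by dévissage and Shapiro's lemma over an open subgroup acting trivially on `A` and `μ_p`,
to the one arithmetic input "`H²(G_S(K′), μ_p)` finite" (Kummer theory on the `S`-units: finiteness of
the `S`-class group and of `S`).  This file is that REDUCTION for degree `2`, with the arithmetic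
input left as a hypothesis in the binders of the sibling `RestrictedRamificationCdTwoOfH3Mu` ((H3μ)):

> **(H2μ-fin)_{K,S,p}**: for a `G_{K,S}`-module structure `ρ₀` on `μ_p(K̄)` and every OPEN subgroup
> `U ≤ G_{K,S}` acting trivially on `μ_p`: `H²(U, μ_p)` is finite (Mathlib's continuous cohomology).

* `finite_restrictedCohomology_two_of_forall_H2_mu` — for `S` FINITE, `p` prime, `ρ₀` as above with
  (H2μ-fin): `Finite (restrictedCohomology ρ S 2)` for every finite discrete `p`-primary `Γ_K`-module
  `M` (the `G_S`-cohomology of `M^{N_S}`, the currency of `finite_restrictedCohomology` /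
  `tateGlobalEulerPoincareCharacteristic`).  Proof: the generic dévissage
  `ContinuousRep.finite_continuousCohomology_two_of_isPrimaryTorsion` over the profinite group
  `G_{K,S}` applied to the `G_{K,S}`-module `M^{N_S}`, with `H¹`-finiteness from Hermite
  (`ContinuousRep.finite_continuousCohomology_one` ∘ `finite_setOf_isOpen_index_le_galoisGroupUnramifiedOutside`).
* `finite_restrictedCohomology_two_of_forall_H2_mu'` — the same with `ρ₀` produced for you when
  `S ⊇ S_p` (`exists_continuousRep_galoisGroupAbove_mu`), hypothesis quantified over all lifts `ρ₀`
  of the Galois action, exactly as (H3μ)_K.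
* `finite_H_two_of_forall_H2_mu` — the `ContinuousRep (GaloisGroupUnramifiedOutside K S) ℤ A`
  reading (Greenberg's currency, `RestrictedRamificationFiniteCoefficients`).

Lane «TATE-EPC-TC» of cell `bsd-eis` (crux `GoodLatticeBDPValue`, stmt-BirchSwinnertonDyer-19032),
brick B1b; the input (H2μ-fin) is brick B1a (Kummer on `E_S`, NSW (8.3.11)).  HONEST FRAMING: a
reduction; no case of (8.3.20), of Tate's theorem or of BSD is proved unconditionally here.

## References
* J. Neukirch, A. Schmidt, K. Wingberg, *Cohomology of Number Fields*, 2nd ed. (2008), (8.3.20) and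
  its proof, (8.3.11). [NeukirchSchmidtWingberg2008]
* D. Harari, *Galois Cohomology and Class Field Theory* (2020), Cor. 17.17 (p. 295). [Harari2020]
* J. S. Milne, *Arithmetic Duality Theorems*, 2nd ed. (2006), I Lemma 4.14, Cor. 4.15. [MilneADT2006]
-/

noncomputable section

open CategoryTheory Function NumberField Field IsDedekindDomain Topology
open scoped NumberField

namespace Literature.NumberTheory.GaloisCohomology

open Literature.NumberTheory.GaloisRepresentations
open Literature.NumberTheory.GaloisRepresentations.DiscreteGaloisModule (mu MuCarrier mu_apply_apply
  restrictedCohomology)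
open _root_.TopRep _root_.ContRepresentation _root_.ContinuousCohomology

universe u

variable {K : Type} [Field K] [NumberField K]

/-- `#μ_p(K̄) = p`. [cite: NeukirchSchmidtWingberg2008, (8.3.20) (proof)] -/
theorem natCard_muCarrier (p : ℕ) [hp : Fact p.Prime] : Nat.card (MuCarrier K p) = p := by
  haveI : NeZero ((p : ℕ) : K) := ⟨Nat.cast_ne_zero.2 hp.out.ne_zero⟩
  haveI : NeZero p := ⟨hp.out.ne_zero⟩
  haveI := AlgebraicClosure.hasEnoughRootsOfUnity K p
  change Nat.card (rootsOfUnity p (AlgebraicClosure K)) = p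
  exact HasEnoughRootsOfUnity.natCard_rootsOfUnity _ p

/-- `μ_p(K̄)` is finite. [cite: NeukirchSchmidtWingberg2008, (8.3.20) (proof)] -/
theorem finite_muCarrier (p : ℕ) [hp : Fact p.Prime] : Finite (MuCarrier K p) :=
  Nat.finite_of_card_ne_zero (by rw [natCard_muCarrier]; exact hp.out.ne_zero)

/-- **`H²(G_{K,S}, A)` is finite for every finite discrete `p`-primary `G_{K,S}`-module `A`, `S`
finite, FROM (H2μ-fin)** (NSW (8.3.20) for `r = 2`, proof: dévissage + Shapiro + Hermite), in the
`ContinuousRep (GaloisGroupUnramifiedOutside K S) ℤ A` currency.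
[cite: NeukirchSchmidtWingberg2008, (8.3.20) (proof)] [cite: MilneADT2006, I Lemma 4.14] -/
theorem finite_H_two_of_forall_H2_mu {S : Set (HeightOneSpectrum (𝓞 K))} (hS : S.Finite)
    {p : ℕ} [Fact p.Prime] (ρ₀ : ContinuousRep (GaloisGroupUnramifiedOutside K S) ℤ (MuCarrier K p))
    (h : ∀ (U : Subgroup (GaloisGroupUnramifiedOutside K S)),
      IsOpen (U : Set (GaloisGroupUnramifiedOutside K S)) →
      (∀ g ∈ U, ∀ v : MuCarrier K p, ρ₀ g v = v) →
        Finite (continuousCohomology 2 (ρ₀.restrict (subgroupIncl U)).toTopRep))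
    (A : Type) [AddCommGroup A] [TopologicalSpace A] [DiscreteTopology A] [Finite A]
    (τ : ContinuousRep (GaloisGroupUnramifiedOutside K S) ℤ A) (hA : IsPrimaryTorsion p A) :
    Finite (continuousCohomology 2 τ.toTopRep) := by
  haveI : TotallyDisconnectedSpace (GaloisGroupUnramifiedOutside K S) :=
    Literature.GroupTheory.ProfiniteSubquotients.totallyDisconnectedSpace_quotient
      (ramificationSubgroup K S) (ramificationSubgroup_isClosed K S)
  haveI : Finite (MuCarrier K p) := finite_muCarrier p
  exact ContinuousRep.finite_continuousCohomology_two_of_isPrimaryTorsion ρ₀ (natCard_muCarrier p)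
    (fun N _ _ _ _ σ _ => σ.finite_continuousCohomology_one
      fun n => finite_setOf_isOpen_index_le_galoisGroupUnramifiedOutside K hS n)
    h A τ hA

/-- **`H²(G_S, M^{N_S})` is finite for every finite discrete `p`-primary `Γ_K`-module `M`, `S` finite,
FROM (H2μ-fin)** — NSW (8.3.20) for `r = 2` in the currency `restrictedCohomology ρ S 2` of the named
facts `finite_restrictedCohomology` / `tateGlobalEulerPoincareCharacteristic`, for a GIVEN
`G_{K,S}`-module structure `ρ₀` on `μ_p`.  (No unramifiedness of `M` is needed: `restrictedCohomology`
is the cohomology of the `G_S`-module `M^{N_S}`, finite and `p`-primary with `M`.)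
[cite: NeukirchSchmidtWingberg2008, (8.3.20) (proof)] [cite: Harari2020, Cor. 17.17 (p. 295)] -/
theorem finite_restrictedCohomology_two_of_forall_H2_mu {S : Set (HeightOneSpectrum (𝓞 K))}
    (hS : S.Finite) {p : ℕ} [Fact p.Prime]
    (ρ₀ : ContinuousRep (GaloisGroupUnramifiedOutside K S) ℤ (MuCarrier K p))
    (h : ∀ (U : Subgroup (GaloisGroupUnramifiedOutside K S)),
      IsOpen (U : Set (GaloisGroupUnramifiedOutside K S)) →
      (∀ g ∈ U, ∀ v : MuCarrier K p, ρ₀ g v = v) →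
        Finite (continuousCohomology 2 (ρ₀.restrict (subgroupIncl U)).toTopRep))
    (M : Type) [AddCommGroup M] [TopologicalSpace M] [DiscreteTopology M] [Finite M]
    (ρ : DiscreteGaloisModule K M) (hM : IsPrimaryTorsion p M) :
    Finite (restrictedCohomology ρ S 2) :=
  finite_H_two_of_forall_H2_mu hS ρ₀ h _ (ρ.quotientInvariants (ramificationSubgroup K S))
    (ContinuousRep.isPrimaryTorsion_submodule hM _)

/-- **NSW (8.3.20), `r = 2`, from (H2μ-fin)_{K,S,p} quantified over the lifts `ρ₀`** (the shape of
(H3μ)_K in `RestrictedRamificationCdTwoOfH3Mu`): for `S` finite containing the places above `p`, if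
for every `G_{K,S}`-module structure `ρ₀` on `μ_p` lifting the Galois action and every open
`U ≤ G_{K,S}` fixing `μ_p` the group `H²(U, μ_p)` is finite, then `H²(G_S, M^{N_S})` is finite for
every finite discrete `p`-primary `Γ_K`-module `M` (a lift `ρ₀` exists since `N_S` fixes `μ_p` for
`S ⊇ S_p`, `exists_continuousRep_galoisGroupAbove_mu`).
[cite: NeukirchSchmidtWingberg2008, (8.3.20) (proof)] [cite: MilneADT2006, I Cor. 4.15] -/
theorem finite_restrictedCohomology_two_of_forall_H2_mu' {S : Set (HeightOneSpectrum (𝓞 K))}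
    (hS : S.Finite) {p : ℕ} [Fact p.Prime]
    (hSp : ∀ v : HeightOneSpectrum (𝓞 K), ((p : ℕ) : 𝓞 K) ∈ v.asIdeal → v ∈ S)
    (h : ∀ (ρ₀ : ContinuousRep (GaloisGroupUnramifiedOutside K S) ℤ (MuCarrier K p)),
      (∀ (σ : absoluteGaloisGroup K) (v : MuCarrier K p),
          ρ₀ (toUnramifiedQuot K S σ) v = mu K p σ v) →
      ∀ (U : Subgroup (GaloisGroupUnramifiedOutside K S)),
        IsOpen (U : Set (GaloisGroupUnramifiedOutside K S)) →
        (∀ g ∈ U, ∀ v : MuCarrier K p, ρ₀ g v = v) →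
          Finite (continuousCohomology 2 (ρ₀.restrict (subgroupIncl U)).toTopRep))
    (M : Type) [AddCommGroup M] [TopologicalSpace M] [DiscreteTopology M] [Finite M]
    (ρ : DiscreteGaloisModule K M) (hM : IsPrimaryTorsion p M) :
    Finite (restrictedCohomology ρ S 2) := by
  haveI : NeZero p := ⟨(Fact.out : p.Prime).ne_zero⟩
  obtain ⟨ρ₀, hρ₀, -⟩ := exists_continuousRep_galoisGroupAbove_mu S (⊤ : Subgroup (absoluteGaloisGroup K))
    (N := p) (fun n hn v => by
      apply MuCarrier.toAdditive.injective
      rw [mu_apply_apply]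
      apply congrArg Additive.ofMul
      apply Subtype.ext
      rw [absoluteGaloisGroup.coe_smul_rootsOfUnity]
      exact Units.ext (smul_units_eq_self_of_mem_ramificationSubgroup (N := p) hSp _
        ((mem_rootsOfUnity _ _).1 (MuCarrier.toAdditive v).toMul.2) n hn))
  exact finite_restrictedCohomology_two_of_forall_H2_mu hS ρ₀ (h ρ₀ hρ₀) M ρ hM

end Literature.NumberTheory.GaloisCohomology

end
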